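import Literature.Probability.Percolation.ArmSeparationOutCatch
import Literature.Probability.Percolation.ArmSeparationWhite
import Literature.Probability.Percolation.ArmSeparationExtArm
import HarnessLib

/-!
# The outer landing move: a tiny-fenced outer tip is carried to the landing free space of `∂Λ_{4M}`

Topic: Probability / Percolation; family `crit-perc`. A brick of the discharge of
`Literature.Probability.Percolation.Nolin2008_twoArm_separation` (Nolin 2008, Thm. 11
[arXiv 0711.4948: Thm. 10], `j = 2`, `σ = BW`; `ArmSeparation.lean`), landing step of the EXTERNAL
extremities (Nolin 2008, Prop. 12 (iii)–(i) [arXiv Prop. 11] and §4.4, p. 12: "if the crossings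
are `η'`-separated at some scale `m`, there exists some landing sequence `I_{η'}` of size `η'` where
the probability of landing is comparable to the probability of just being `η'`-well-separated, and
then we can reach `I_{η'_0}` of size `η'₀` on the next scale"). One colour at a time, in the
normalised picture (open arm, landing on the right side of `∂Λ_{4M}`): a fenced outer arm of `χ`
read in the frame `i` (`TrapFencedArm`, tip on side `0` of `∂Λ_{2M}` in the window `[T₀, T₀ + w)`,
middle tip), together with the corridor events — the beacon about the tip, the outer spoke
(`ArmSeparationOutCatch.lean`), an arc of the thin ring of radius `r > 2M` all of whose tubes are
crossed (containing a tube met by the spoke and a run of pieces of the side `x₀ = r` across the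
target rows), the approach tube out to `∂Λ_{4M}` and the thinned target free space at the landing
row `otgtRow (4M) b` — lands: `χ ∈ extOpenArm n (4M)` (`ArmSeparationExtArm.lean`). This is the
outward twin of `ArmSeparationLandingGlue.lean` / `ArmSeparationMove.lean`.

* `otgtRow`, `otgtV`, and the region lemmas;
* `out_landing_glue` — ring arc, exit run, approach tube and target free space give the landed arm;
* `out_landing_move` — the move;
* `TrapFencedArm.transport`, `out_white_landing_move` — the same for the closed arm, through
  `negFlip` (a fenced closed arm of the frame `ic` is a fenced open arm of `negFlip ω` in the frame
  `(ic + 3) mod 6`, `compl_frameConfig_eq` of `ArmSeparationWhite.lean`).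

## References

* P. Nolin, *Near-critical percolation in two dimensions*, Electron. J. Probab. 13 (2008), §4.2
  Def. 6–8, §4.3 Prop. 12, §4.4 [arXiv 0711.4948: Def. 6–8, Prop. 11, Thm. 10, p. 12]. [Nolin2008]
* H. Kesten, *Scaling relations for 2D-percolation*, Comm. Math. Phys. 109 (1987), Lemma 2. [Kesten1987]

Tree: `TrapFencedArm` (`ArmSeparationOuter.lean`); `obcnCentre`, `otipBox`, `ospokeTube`,
`ospokeEvent`, `out_arm_to_entry`, `norm_mem_of_mem_ospokeBox`, `norm_mem_of_mem_otipBox`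
(`ArmSeparationOutCatch.lean`); `extOpenArm` (`ArmSeparationExtArm.lean`);
`Tube`, `chain_paths'`, `exists_crossings`, `arc`, `thinRing`, `vchunks`, `vPiece`, `vchunks_eq_cons`,
`getLast?_vchunks`, `bounds_of_mem_vchunks`, `isChain_arc_thinRing`, `mem_of_mem_arc`,
`triNorm_mem_of_mem_thinRing` (`ArmSeparationTubes.lean`, `ArmSeparationThinRing.lean`,
`ArmSeparationLandingGlue.lean`); `compl_frameConfig_eq` (`ArmSeparationWhite.lean`); `SpokeMeets`;
`exists_mem_of_cross`.
-/

noncomputable section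

open Set

namespace Literature.Probability.Percolation

open LatticeModels Tube

/-! ### Targets on `∂Λ_{N'}` -/

/-- **The two outer target rows** on the right side of `∂Λ_{N'}`: `-(N'/4 + N'/16)` (`b = true`) and
`-(N'/4 + N'/8 + N'/16)` (`b = false`), both in the landing zone and above the row `-N'/2`. [cite: Nolin2008, §4.2 Def. 8 (arXiv 0711.4948)] -/
def otgtRow (N' : ℕ) (b : Bool) : ℤ :=
  bif b then -((N' / 4 : ℕ) : ℤ) - (N' / 16 : ℕ) else -((N' / 4 : ℕ) : ℤ) - (N' / 8 : ℕ) - (N' / 16 : ℕ)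

/-- Both target sites `(N', otgtRow N' b)` lie in the landing zone of `∂Λ_{N'}`. [cite: Nolin2008, §4.2 Def. 8 (arXiv 0711.4948)] -/
theorem mk_otgtRow_mem_sepLanding (N' : ℕ) (b : Bool) : (![(N' : ℤ), otgtRow N' b] : Site 2) ∈ sepLanding N' := by
  rw [mem_sepLanding, site_mk_apply_zero, site_mk_apply_one]
  refine ⟨rfl, ?_, ?_⟩ <;> cases b <;> simp only [otgtRow, cond_true, cond_false] <;> omega

/-- The two target rows are `N'/8` apart: `otgtRow N' false + N'/8 = otgtRow N' true`. [folklore] -/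
theorem otgtRow_false_add (N' : ℕ) : otgtRow N' false + (N' / 8 : ℕ) = otgtRow N' true := by
  simp only [otgtRow, cond_true, cond_false]; ring

/-- The target rows lie in `[-N'/2 + N'/16, -N'/4 - N'/16]`. [folklore] -/
theorem otgtRow_mem (N' : ℕ) (b : Bool) :
    -((N' / 2 : ℕ) : ℤ) + (N' / 16 : ℕ) ≤ otgtRow N' b ∧ otgtRow N' b ≤ -((N' / 4 : ℕ) : ℤ) - (N' / 16 : ℕ) := by
  cases b <;> simp only [otgtRow, cond_true, cond_false] <;> omega

/-- **The thinned target free space** `[N'+1, N'+N'/16] × [t - N'/64, t + N'/64]`, crossed vertically. [cite: Nolin2008, §4.2 Def. 6 (arXiv 0711.4948)] -/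
def otgtV (N' : ℕ) (t : ℤ) : Set (SiteConfig (Site 2)) :=
  triVCross ((N' : ℤ) + 1) (t - (N' / 64 : ℕ)) (N' / 16 - 1) (2 * (N' / 64))

/-- The thinned target free space lies inside the outer free space at `(N', t)` (`16 ≤ N'`). [cite: Nolin2008, §4.2 Def. 6 (arXiv 0711.4948)] -/
theorem otgtVStrip_subset_sepOuterFence {N' : ℕ} (hN' : 16 ≤ N') (t : ℤ) :
    triStrip ((N' : ℤ) + 1) (t - (N' / 64 : ℕ)) (N' / 16 - 1) (2 * (N' / 64)) ⊆ sepOuterFence N' ![(N' : ℤ), t] := by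
  intro v hv
  rw [mem_triStrip] at hv
  rw [mem_sepOuterFence, site_mk_apply_one]
  have h16 : ((N' / 16 - 1 : ℕ) : ℤ) = (N' / 16 : ℕ) - 1 := by omega
  rw [h16] at hv
  push_cast at hv
  omega

/-- The approach tube `[a, N' + N'/16] × [t, t + N'/64]` lies in the arm region
`{n ≤ |v| ≤ N'} ∪ S̊_{N'/8}(N', t)` (`64 ≤ N'`, `n ≤ a`, `0 ≤ a`, `-N' ≤ t`, `t + N'/64 ≤ 0`). [cite: Nolin2008, §4.2 Def. 6 (arXiv 0711.4948)] -/
theorem otgtHStrip_subset {n N' : ℕ} {a : ℤ} {W : ℕ} (hN' : 64 ≤ N') (hna : (n : ℤ) ≤ a) (ha : 0 ≤ a) (hW : a + W = (N' : ℤ) + (N' / 16 : ℕ))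
    {t : ℤ} (ht : -(N' : ℤ) ≤ t ∧ t + (N' / 64 : ℕ) ≤ 0) :
    triStrip a t W (N' / 64) ⊆ triAnnulusSet n N' ∪ triOpenBall ![(N' : ℤ), t] (N' / 8) := by
  intro v hv
  rw [mem_triStrip] at hv
  rcases le_or_gt (v 0) (N' : ℤ) with h0 | h0
  · refine Or.inl ⟨le_triNorm_iff_lin.2 (Or.inl (by omega)), triNorm_le_iff_lin.2 ?_⟩
    omega
  · refine Or.inr ?_
    rw [mem_triOpenBall, triNorm_lt_iff_lin]
    simp only [Pi.sub_apply, site_mk_apply_zero, site_mk_apply_one]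
    omega

/-! ### The gluing -/

/-- **Outer landing glue.** In a configuration `χ`, let the inner end `a₀` (a site of norm `n`) of
an arm be joined (inside a region `R₁` of the arm region) to the start `X Te` of the crossing of
some tube `Te` of a chain of tubes `E :: L`, all crossed by `χ` with the crossings `(X T, Y T)`, all
inside the annulus `{n ≤ |v| ≤ N'}`, and containing the run `V_{j₀}, …, V_{j₀+d}` of pieces of the
side `x₀ = r` whose starts span the rows `[t, t + N'/64]`. If moreover the approach tube
`[r - 2e, N' + N'/16] × [t, t + N'/64]` is crossed horizontally and the thinned target free space at
the landing row `t` vertically, then `χ ∈ extOpenArm n N'`: the target crossing meets the approach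
crossing at the attaching site, the approach crossing meets the run, and the run's first start is
joined to `X Te` along the chain. [cite: Nolin2008, §4.3 Prop. 12 (proof) (arXiv 0711.4948: Prop. 11)] -/
theorem out_landing_glue {n N' : ℕ} {χ : SiteConfig (Site 2)} {t : ℤ} (ht : -(N' : ℤ) ≤ t ∧ t + (N' / 64 : ℕ) ≤ 0)
    (hland : (![(N' : ℤ), t] : Site 2) ∈ sepLanding N')
    {E : Tube} {L : List Tube} (hch : List.IsChain Crosses (E :: L)) {X Y : Tube → Site 2}
    (hXY : ∀ T ∈ E :: L, T.IsCrossing χ (X T) (Y T)) (hLreg : ∀ T ∈ E :: L, T.box ⊆ triAnnulusSet n N')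
    {R₁ : Set (Site 2)} (hR₁ : R₁ ⊆ triAnnulusSet n N' ∪ triOpenBall ![(N' : ℤ), t] (N' / 8)) {Te : Tube} (hTe : Te ∈ E :: L)
    {a₀ : Site 2} (ha₀ : triNorm a₀ = n) (P₁ : PathIn triGraph (R₁ ∩ χ) a₀ (X Te))
    {r e s j₀ d : ℕ} (hSL : ∀ T ∈ vchunks r (-(r : ℤ)) e s j₀ (d + 1), T ∈ E :: L)
    (hlo : -(r : ℤ) + j₀ * s - e ≤ t) (hhi : t + (N' / 64 : ℕ) ≤ -(r : ℤ) + (j₀ + d) * s - e)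
    (hnr : (n : ℤ) ≤ (r : ℤ) - 2 * e) (he : 2 * e ≤ r) {W : ℕ} (hW : (r : ℤ) - 2 * e + W = N' + (N' / 16 : ℕ))
    (hH : χ ∈ triHCross ((r : ℤ) - 2 * e) t W (N' / 64)) (hV : χ ∈ otgtV N' t) (hN' : 64 ≤ N') (hrN : (r : ℤ) + e ≤ N') :
    χ ∈ extOpenArm n N' := by
  have h16 : ((N' / 16 - 1 : ℕ) : ℤ) = (N' / 16 : ℕ) - 1 := by omega
  have he' : 2 * (e : ℤ) ≤ r := by exact_mod_cast he
  -- (1) the target free space and the approach tube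
  obtain ⟨bb, tt, hbb, htt, PF⟩ := hV
  obtain ⟨SF, hSF, PF', TF⟩ := PF.exists_support
  obtain ⟨hl, hr, hhl, hhr, PH⟩ := hH
  obtain ⟨SH, hSH, PH', TH⟩ := PH.exists_support
  have hSFb : ∀ z ∈ SF, (N' : ℤ) + 1 ≤ z 0 ∧ z 0 ≤ (N' : ℤ) + (N' / 16 : ℕ) := fun z hz => by
    have := (hSF hz).1; rw [mem_triStrip, h16] at this; omega
  have hSHb : ∀ z ∈ SH, t ≤ z 1 ∧ z 1 ≤ t + (N' / 64 : ℕ) := fun z hz => by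
    have := (hSH hz).1; rw [mem_triStrip] at this; omega
  obtain ⟨u, huH, huF⟩ := exists_mem_of_cross (L := (N' : ℤ) + 1) (R := (N' : ℤ) + (N' / 16 : ℕ))
    (B := t - (N' / 64 : ℕ)) (T := t + (N' / 64 : ℕ)) (by omega) (by omega)
    PH' (by omega) (by rw [hhr]; omega) (fun z hz _ _ => by have := hSHb z hz; omega)
    PF' (by omega) (by rw [htt]; push_cast; ring_nf; omega) (fun z hz _ _ => hSFb z hz)
  have outer : OpenVCrossThrough (sepOuterFence N' ![(N' : ℤ), t]) ((![(N' : ℤ), t] : Site 2) 1 - (N' / 64 : ℕ))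
      ((![(N' : ℤ), t] : Site 2) 1 + (N' / 64 : ℕ)) χ u := by
    have hsub : SF ⊆ sepOuterFence N' ![(N' : ℤ), t] ∩ χ := fun z hz =>
      ⟨otgtVStrip_subset_sepOuterFence (by omega) t (hSF hz).1, (hSF hz).2⟩
    refine ⟨bb, tt, ?_, ?_, (TF u huF).mono hsub, ((TF u huF).symm.trans (TF tt PF'.right_mem)).mono hsub⟩
    · rw [site_mk_apply_one, hbb]
    · rw [site_mk_apply_one, htt]; push_cast; ring
  -- (2) the exit run, read with the prescribed crossings
  obtain ⟨L₀, hL₀⟩ := vchunks_eq_cons (r : ℤ) (-(r : ℤ)) e s j₀ d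
  have hchSL : List.IsChain Crosses (vPiece r (-(r : ℤ)) e s j₀ :: L₀) := hL₀ ▸ isChain_vchunks _ _ e s j₀ (d + 1)
  have hmemSL : ∀ T ∈ vPiece r (-(r : ℤ)) e s j₀ :: L₀, T ∈ vchunks r (-(r : ℤ)) e s j₀ (d + 1) := fun T hT => hL₀ ▸ hT
  have runs := chain_paths' X Y (vPiece r (-(r : ℤ)) e s j₀) L₀ hchSL (fun T hT => hXY T (hSL T (hmemSL T hT)))
  have hlast : vPiece r (-(r : ℤ)) e s (j₀ + d) ∈ vPiece r (-(r : ℤ)) e s j₀ :: L₀ := by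
    rw [← hL₀]; exact List.mem_of_mem_getLast? (by rw [getLast?_vchunks]; rfl)
  have PV := runs _ hlast
  obtain ⟨SV, hSV, PV', TV⟩ := PV.exists_support
  have hX0 : X (vPiece r (-(r : ℤ)) e s j₀) 1 = -(r : ℤ) + j₀ * s - e := by
    have := (hXY _ (hSL _ (hmemSL _ List.mem_cons_self))).1
    exact this.1.trans (by simp only [vPiece])
  have hX1 : X (vPiece r (-(r : ℤ)) e s (j₀ + d)) 1 = -(r : ℤ) + (j₀ + d) * s - e := by
    have := (hXY _ (hSL _ (hmemSL _ hlast))).1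
    exact this.1.trans (by simp only [vPiece, Nat.cast_add])
  have hSVb : ∀ z ∈ SV, (r : ℤ) - e ≤ z 0 ∧ z 0 ≤ (r : ℤ) + e := fun z hz => by
    obtain ⟨⟨T, hT, hzT⟩, -⟩ := hSV hz
    have := bounds_of_mem_vchunks (r : ℤ) (-(r : ℤ)) e s (hmemSL T hT) hzT
    exact ⟨this.1, this.2.1⟩
  obtain ⟨v, hvH, hvV⟩ := exists_mem_of_cross (L := (r : ℤ) - e) (R := (r : ℤ) + e) (B := t) (T := t + (N' / 64 : ℕ))
    (by omega) (by omega) PH' (by omega) (by rw [hhr]; omega) (fun z hz _ _ => hSHb z hz)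
    PV' (by rw [hX0]; exact hlo) (by rw [hX1]; exact hhi) (fun z hz _ _ => hSVb z hz)
  -- (3) along the chain to the entry tube, then to the arm
  have PA := (chain_paths' X Y E L hch hXY Te hTe).symm.trans (chain_paths' X Y E L hch hXY _ (hSL _ (hmemSL _ List.mem_cons_self)))
  -- (4) assemble inside the arm region
  set R : Set (Site 2) := triAnnulusSet n N' ∪ triOpenBall ![(N' : ℤ), t] (N' / 8) with hR
  have hHreg : SH ⊆ R ∩ χ := fun z hz =>
    ⟨otgtHStrip_subset hN' hnr (by omega) hW ht (hSH hz).1, (hSH hz).2⟩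
  have hann : triAnnulusSet n N' ⊆ R := fun z hz => Or.inl hz
  have hVreg : SV ⊆ R ∩ χ := fun z hz => by
    obtain ⟨⟨T, hT, hzT⟩, hzχ⟩ := hSV hz
    exact ⟨hann (hLreg T (hSL T (hmemSL T hT)) hzT), hzχ⟩
  have hAreg : boxAll (E :: L) ∩ χ ⊆ R ∩ χ := by
    rintro z ⟨⟨T, hT, hzT⟩, hzχ⟩; exact ⟨hann (hLreg T hT hzT), hzχ⟩
  have Q1 : PathIn triGraph (R ∩ χ) a₀ (X Te) := P₁.mono fun z hz => ⟨hR₁ hz.1, hz.2⟩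
  have Q2 : PathIn triGraph (R ∩ χ) (X Te) (X (vPiece r (-(r : ℤ)) e s j₀)) := PA.mono hAreg
  have Q3 : PathIn triGraph (R ∩ χ) (X (vPiece r (-(r : ℤ)) e s j₀)) v := (TV v hvV).mono hVreg
  have Q4 : PathIn triGraph (R ∩ χ) v u := ((TH v hvH).symm.trans (TH u huH)).mono hHreg
  exact ⟨![(N' : ℤ), t], u, a₀, hland, ha₀, outer, ((Q1.trans Q2).trans Q3).trans Q4⟩

/-! ### The move -/

/-- **The outer landing move.** A fenced outer arm `Fo` of `χ` read in the frame `i` (middle tip: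
`-2M + R₀ ≤ z₁ ≤ -R₀`, `4k + 2 ≤ R₀`, tip row in the window `[T₀, T₀ + w)`, `4w ≤ k`, `4 ≤ k`); beacon, spoke (`4ε ≤ k`,
`2k ≤ L`), an arc of the thin ring of radius `r` (`1 ≤ s ∣ r`, `2e ≤ r`) all crossed, containing a tube
`Te` met by the spoke and the run `V_{j₀}, …, V_{j₀+d}` across the rows
`[otgtRow (4M) b, otgtRow (4M) b + 4M/64]`; approach tube and thinned target free space crossed; and
the size conditions keeping every piece inside the annulus `{n ≤ |v| ≤ 4M}` beyond `Λ_{2M}`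
(`n ≤ M`, `2k + L ≤ 2M`, `r + 2e ≤ 4M`, `2M < r - s - 2e`). Then `χ ∈ extOpenArm n (4M)`. [cite: Nolin2008, §4.3 Prop. 12 and §4.4 (arXiv 0711.4948: Prop. 11, Thm. 10, p. 12)] -/
theorem out_landing_move {M n k₀ K R₀ : ℕ} (hnM : n ≤ M) {i : ℕ} (hi : i < 6) {χ : SiteConfig (Site 2)}
    (Fo : TrapFencedArm M n k₀ K (frameConfig i χ)) (hmid : -(2 * (M : ℤ)) + R₀ ≤ Fo.z 1 ∧ Fo.z 1 ≤ -(R₀ : ℤ))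
    (hR : 4 * Fo.k + 2 ≤ R₀)
    {T₀ : ℤ} {w : ℕ} (hwk : 4 * w ≤ Fo.k) (hk : 4 ≤ Fo.k) (hwin : T₀ ≤ Fo.z 1 ∧ Fo.z 1 < T₀ + w)
    (hB : frameConfig i χ ∈ triFrameAt (obcnCentre M Fo.k T₀ w) (Fo.k / 2))
    {L ε : ℕ} (hε : 4 * ε ≤ Fo.k) (hL : 2 * Fo.k ≤ L) (hSp : χ ∈ ospokeEvent i M Fo.k T₀ w L ε)
    {r e s a len : ℕ} (hs : 1 ≤ s) (hsr : s ∣ r) (hsr' : s ≤ r) (he : 2 * e ≤ r)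
    (harc : χ ∈ eventAll (arc (thinRing r e s) a len))
    {Te : Tube} (hTe : Te ∈ arc (thinRing r e s) a len) (hJ : SpokeMeets i (ospokeTube M Fo.k T₀ w L ε) Te)
    {b : Bool} {j₀ d : ℕ} (hSL : ∀ T ∈ vchunks r (-(r : ℤ)) e s j₀ (d + 1), T ∈ arc (thinRing r e s) a len)
    (hlo : -(r : ℤ) + j₀ * s - e ≤ otgtRow (4 * M) b) (hhi : otgtRow (4 * M) b + (4 * M / 64 : ℕ) ≤ -(r : ℤ) + (j₀ + d) * s - e)
    {W : ℕ} (hW : (r : ℤ) - 2 * e + W = 4 * M + (4 * M / 16 : ℕ))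
    (hH : χ ∈ triHCross ((r : ℤ) - 2 * e) (otgtRow (4 * M) b) W (4 * M / 64)) (hV : χ ∈ otgtV (4 * M) (otgtRow (4 * M) b))
    (hM : 64 ≤ M) (hkL : 2 * (Fo.k : ℤ) + L ≤ 2 * M) (hr2 : 2 * (M : ℤ) < (r : ℤ) - s - 2 * e) (hr4 : (r : ℤ) + 2 * e ≤ 4 * M) :
    χ ∈ extOpenArm n (4 * M) := by
  have hwk' : 4 * (w : ℤ) ≤ Fo.k := by exact_mod_cast hwk
  have hε' : 4 * (ε : ℤ) ≤ Fo.k := by exact_mod_cast hε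
  have hR' : 4 * (Fo.k : ℤ) + 2 ≤ R₀ := by exact_mod_cast hR
  have hnM' : (n : ℤ) ≤ M := by exact_mod_cast hnM
  obtain ⟨hz0, hz1, hz2⟩ := trapO_coord Fo.z_mem
  obtain ⟨hm1, hm2⟩ := hmid
  have ht4 : Fo.z 1 + 4 * Fo.k + 2 ≤ 0 := by omega
  obtain ⟨htr1, htr2⟩ := otgtRow_mem (4 * M) b
  -- the arc as a nonempty chain with prescribed crossings
  obtain ⟨E, L', hEL⟩ := List.exists_cons_of_ne_nil (List.ne_nil_of_mem hTe)
  have harc' : ∀ T ∈ E :: L', χ ∈ T.event := fun T hT => harc T (hEL ▸ hT)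
  have hch : List.IsChain Crosses (E :: L') := hEL ▸ isChain_arc_thinRing hs hsr hsr' a len
  obtain ⟨X, Y, hXY⟩ := exists_crossings harc'
  have hTe' : Te ∈ E :: L' := hEL ▸ hTe
  have hring : ∀ T ∈ E :: L', T ∈ thinRing r e s := fun T hT => mem_of_mem_arc (hEL ▸ hT : T ∈ arc (thinRing r e s) a len)
  have hLreg : ∀ T ∈ E :: L', T.box ⊆ triAnnulusSet n (4 * M) := fun T hT v hv => by
    have := triNorm_mem_of_mem_thinRing he (hring T hT) hv
    rw [mem_triAnnulusSet]; push_cast; constructor <;> omega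
  -- the hook
  have P₁ := out_arm_to_entry hnM hi Fo hwk hk hwin ht4 hB hε hL hSp (hXY Te hTe') hJ
  -- everything lies in the arm region
  have hreg : frameIso i '' ((ospokeTube M Fo.k T₀ w L ε).box ∪ (triAnnSet n (2 * M) ∪ otipBox M (Fo.z 1) Fo.k)) ∪ Te.box ⊆
      triAnnulusSet n (4 * M) ∪ triOpenBall ![((4 * M : ℕ) : ℤ), otgtRow (4 * M) b] (4 * M / 8) := by
    have hann : ∀ v : Site 2, (n : ℤ) ≤ triNorm v → triNorm v ≤ 4 * M →
        v ∈ triAnnulusSet n (4 * M) ∪ triOpenBall ![((4 * M : ℕ) : ℤ), otgtRow (4 * M) b] (4 * M / 8) :=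
      fun v h1 h2 => Or.inl ⟨h1, by push_cast; exact h2⟩
    rintro v (⟨u, hu, rfl⟩ | hv)
    · rcases hu with hu | hu | hu
      · have := norm_mem_of_mem_ospokeBox hk hε (T₀ := T₀) (w := w) (L := L) (M := M) (by omega) (by omega) hu
        exact hann _ (by rw [triNorm_frameIso i hi]; omega) (by rw [triNorm_frameIso i hi]; omega)
      · rw [mem_triAnnSet] at hu
        exact hann _ (by rw [triNorm_frameIso i hi]; exact hu.1) (by rw [triNorm_frameIso i hi]; push_cast at hu; omega)
      · have := norm_mem_of_mem_otipBox (k := Fo.k) (by omega) (by omega) hu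
        exact hann _ (by rw [triNorm_frameIso i hi]; omega) (by rw [triNorm_frameIso i hi]; omega)
    · have := hLreg Te hTe' hv
      rw [mem_triAnnulusSet] at this
      push_cast at this
      exact hann v this.1 this.2
  -- glue
  have hna : triNorm (frameIso i Fo.a) = n := by rw [triNorm_frameIso i hi, Fo.norm_a]
  have glue := out_landing_glue (n := n) (N' := 4 * M) (t := otgtRow (4 * M) b) ⟨by push_cast; omega, by omega⟩
    (mk_otgtRow_mem_sepLanding (4 * M) b) hch hXY hLreg
    (by push_cast; exact hreg) hTe' hna P₁ (fun T hT => hEL ▸ hSL T hT) hlo hhi (by omega) he (by push_cast; exact hW) hH hV (by omega)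
    (by push_cast; omega)
  exact glue

/-! ### The white move -/

namespace TrapFencedArm

/-- **Transport of a fenced outer arm** along an equality of configurations. [folklore] -/
def transport {M n k₀ K : ℕ} {χ χ' : SiteConfig (Site 2)} (hχ : χ = χ') (F : TrapFencedArm M n k₀ K χ) :
    TrapFencedArm M n k₀ K χ' := hχ ▸ F

/-- Transport keeps the tip. [folklore] -/
@[simp] theorem transport_z {M n k₀ K : ℕ} {χ χ' : SiteConfig (Site 2)} (hχ : χ = χ') (F : TrapFencedArm M n k₀ K χ) :
    (F.transport hχ).z = F.z := by
  subst hχ; rfl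

/-- Transport keeps the scale index. [folklore] -/
@[simp] theorem transport_j {M n k₀ K : ℕ} {χ χ' : SiteConfig (Site 2)} (hχ : χ = χ') (F : TrapFencedArm M n k₀ K χ) :
    (F.transport hχ).j = F.j := by
  subst hχ; rfl

/-- Transport keeps the scale. [folklore] -/
@[simp] theorem transport_k {M n k₀ K : ℕ} {χ χ' : SiteConfig (Site 2)} (hχ : χ = χ') (F : TrapFencedArm M n k₀ K χ) :
    (F.transport hχ).k = F.k := by
  subst hχ; rfl

end TrapFencedArm

/-- **The white outer landing move.** A fenced closed outer arm of `ω` in the frame `ic` (an open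
arm of `(frameConfig ic ω)ᶜ`, with a middle tip) is a fenced open arm of `negFlip ω` in the
frame `ic' = (ic + 3) mod 6` (`compl_frameConfig_eq`); if the corridor events of the outer landing
move hold for `negFlip ω` in that frame, then `negFlip ω ∈ extOpenArm n (4M)`, i.e. the closed arm of
`ω` lands on the left side of `∂Λ_{4M}`. [cite: Nolin2008, §4.3 Prop. 12 and §4.4 (arXiv 0711.4948: Prop. 11, Thm. 10, p. 12)] -/
theorem out_white_landing_move {M n k₀ K R₀ : ℕ} (hnM : n ≤ M) {ic : ℕ} (hic : ic < 6) {ω : SiteConfig (Site 2)}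
    (Fc : TrapFencedArm M n k₀ K (frameConfig ic ω)ᶜ) (hmid : -(2 * (M : ℤ)) + R₀ ≤ Fc.z 1 ∧ Fc.z 1 ≤ -(R₀ : ℤ))
    (hR : 4 * Fc.k + 2 ≤ R₀)
    {T₀ : ℤ} {w : ℕ} (hwk : 4 * w ≤ Fc.k) (hk : 4 ≤ Fc.k) (hwin : T₀ ≤ Fc.z 1 ∧ Fc.z 1 < T₀ + w)
    (hB : frameConfig ((ic + 3) % 6) (negFlip ω) ∈ triFrameAt (obcnCentre M Fc.k T₀ w) (Fc.k / 2))
    {L ε : ℕ} (hε : 4 * ε ≤ Fc.k) (hL : 2 * Fc.k ≤ L) (hSp : negFlip ω ∈ ospokeEvent ((ic + 3) % 6) M Fc.k T₀ w L ε)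
    {r e s a len : ℕ} (hs : 1 ≤ s) (hsr : s ∣ r) (hsr' : s ≤ r) (he : 2 * e ≤ r)
    (harc : negFlip ω ∈ eventAll (arc (thinRing r e s) a len))
    {Te : Tube} (hTe : Te ∈ arc (thinRing r e s) a len) (hJ : SpokeMeets ((ic + 3) % 6) (ospokeTube M Fc.k T₀ w L ε) Te)
    {b : Bool} {j₀ d : ℕ} (hSL : ∀ T ∈ vchunks r (-(r : ℤ)) e s j₀ (d + 1), T ∈ arc (thinRing r e s) a len)
    (hlo : -(r : ℤ) + j₀ * s - e ≤ otgtRow (4 * M) b) (hhi : otgtRow (4 * M) b + (4 * M / 64 : ℕ) ≤ -(r : ℤ) + (j₀ + d) * s - e)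
    {W : ℕ} (hW : (r : ℤ) - 2 * e + W = 4 * M + (4 * M / 16 : ℕ))
    (hH : negFlip ω ∈ triHCross ((r : ℤ) - 2 * e) (otgtRow (4 * M) b) W (4 * M / 64))
    (hV : negFlip ω ∈ otgtV (4 * M) (otgtRow (4 * M) b))
    (hM : 64 ≤ M) (hkL : 2 * (Fc.k : ℤ) + L ≤ 2 * M) (hr2 : 2 * (M : ℤ) < (r : ℤ) - s - 2 * e) (hr4 : (r : ℤ) + 2 * e ≤ 4 * M) :
    negFlip ω ∈ extOpenArm n (4 * M) := by
  set Fc' := Fc.transport (compl_frameConfig_eq hic ω) with hFc'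
  have hk' : Fc'.k = Fc.k := TrapFencedArm.transport_k _ _
  have hz' : Fc'.z = Fc.z := TrapFencedArm.transport_z _ _
  have hi' : (ic + 3) % 6 < 6 := Nat.mod_lt _ (by norm_num)
  refine out_landing_move hnM hi' Fc' (by rw [hz']; exact hmid) (by rw [hk']; exact hR) (T₀ := T₀) (w := w)
    (by rw [hk']; exact hwk) (by rw [hk']; exact hk) (by rw [hz']; exact hwin) (by rw [hk']; exact hB) (L := L) (ε := ε)
    (by rw [hk']; exact hε) (by rw [hk']; exact hL) (by rw [hk']; exact hSp) hs hsr hsr' he harc hTe (by rw [hk']; exact hJ)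
    hSL hlo hhi hW hH hV hM (by rw [hk']; exact hkL) hr2 hr4

end Literature.Probability.Percolation
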